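import Summits.HubbardSuperconductivity.HubbardSuperconductivity.Theorems.NodalDiracTwistBridgeNodalToDWaveDiagonalParityFlipLoop

/-!
# The diagonal parity flip at a Dirac point (crux `BridgeNodalToDWave`, line `birth`)

Route `HubbardSuperconductivity/NodalDiracTwist`, crux stmt-HubbardSuperconductivity-10395
(`BridgeNodalToDWave`), skeleton `Cruxes/BridgeNodalToDWave/Lines/birth.lean`, structural input to
stub C (`stub_classificationCore`), lead c12.

The nodal-Dirac package of the route places the four degeneracies of the `(N, S^z = 0)` sector
ground state of the spin-twisted torus `H_L(U, φ)` at the DIAGONAL twists `(±c, ±c)`, with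
cyclic-overlap holonomy `-1` around each.  The diagonal `φ₀ = φ₁` is the fixed line of the swap
`(x₀, x₁) ↦ (x₁, x₀)` of the square torus, second-quantised as the Fock unitary
`Γ = U_{sr 3} = fockD4 (sr 3)`, under which the family is covariant,
`Γ H_L(U, (φ₀, φ₁)) Γ⁻¹ = H_L(U, (φ₁, φ₀))` (`swapCovariance`).  This file proves the rigorous
form of the heuristic "the two levels that cross at a diagonal Dirac point have opposite `x ↔ y`
parity":

* (part 1, `…DiagonalParityFlipLoop.lean`: `prod_overlap_reflectedLoop` — for a polygon with `8m`
  vertices around a diagonal point whose lower half is the `Γ`-image of its upper half, and whose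
  two diagonal vertices are `Γ`-eigenvectors with eigenvalues `d₊`, `d₋`, the cyclic overlap product
  equals `d₋ conj(d₊) |P|²`, `P` the product of the overlaps along the upper half; the mesh
  geometry; the swap transport `isGroundStateInSector_swap`);
* `re_swapSign_mul_lt_zero_of_holonomy_neg` — hence, if the holonomy clause of the package holds
  at a diagonal point `p` (`p₀ = p₁`) for the radius `r` (eventually in the mesh, EVERY choice of
  unit sector ground states on the polygon has `Re ∏ < 0`), then sector ground states `χ₊`, `χ₋`
  at the two diagonal points `p ± (r/√2)(1,1)` of the circle that are `Γ`-eigenvectors,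
  `Γ χ± = d± χ±`, have `Re (d₋ conj d₊) < 0` — no continuity or gap hypothesis is needed;
* `swapSign_opposite_of_holonomy_neg` — if moreover the sector ground states at those two points
  are unique up to scalars, then `Γ χ₊ = ± χ₊`, `Γ χ₋ = ∓ χ₋` with OPPOSITE signs
  (`fockRelabel_mapEquiv_mulVec_eq_self_or_eq_neg`): the swap parity of the ground state flips
  across every diagonal Dirac point.  Registered sub-goal `stub_diagonalParityFlip`.

This is a kernel-checked necessary condition on any state realising the package (binding on
cruxes stmt-10370 / stmt-1622 as well) and an exact-diagonalisation test (compare the `x ↔ y`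
parity of the sector ground state at twists `(t, t)` below and above a gap closing on the
diagonal).

## References

Y. Hatsugai, J. Phys. Soc. Jpn. 75 (2006) 123601 (quantised Berry phases from an antiunitary
symmetry; `ℤ₂` holonomy of a real ground-state bundle); T. Fukui, Y. Hatsugai, H. Suzuki, J. Phys.
Soc. Jpn. 74 (2005) 1674 (lattice link variables / cyclic overlap products); H. C. Longuet-Higgins,
Proc. R. Soc. A 344 (1975) 147 (sign change of a real eigenvector around a degeneracy);
D. J. Scalapino, Phys. Rep. 250 (1995) 329, §2 (point group of the square lattice). No new
definitions, no named facts.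
-/

-- the mandated namespace repeats `HubbardSuperconductivity` (single-problem summit, D-0017)
set_option linter.dupNamespace false

noncomputable section

namespace Summit.HubbardSuperconductivity.HubbardSuperconductivity.Theorems.NodalDiracTwist.BridgeNodalToDWave

open Matrix Finset Literature.MathematicalPhysics.QuantumLattice Literature.Probability.LatticeModels
open Summit.HubbardSuperconductivity.HubbardSuperconductivity.Theorems.NodalDiracTwist

/-! ### The parity flip -/

section Flip

variable (L : ℕ) [NeZero L]

/-- **Holonomy `-1` at a diagonal point forces `Re (d₋ conj d₊) < 0` for the swap eigenvalues at
the two diagonal vertices.**  Let `p` be a diagonal twist (`p₀ = p₁`) and `r` a radius at which the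
holonomy clause of the nodal-Dirac package holds: eventually in the mesh `n`, for EVERY choice of
unit `(N, S^z = 0)` sector ground states of `H_L(U, ·)` at the vertices `p + r (cos 2πi/n, sin 2πi/n)`
the cyclic overlap product has negative real part.  If `χ₊`, `χ₋` are sector ground states at the
diagonal vertices `p + r (cos π/4, sin π/4)`, `p + r (cos 5π/4, sin 5π/4)` with
`U_{sr 3} χ± = d± χ±` (the swap `(x₀,x₁) ↦ (x₁,x₀)`), then `Re (d₋ conj d₊) < 0`.
Proof: take `n = 8m ≥ n₀`, unit ground states `u_i` on the upper half `m ≤ i ≤ 5m` of the polygon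
with `u_m ∝ χ₊`, `u_{5m} ∝ χ₋` (ground states exist at every twist since the sector is non-trivial),
and reflect them to the lower half with `U_{sr 3}` (`isGroundStateInSector_swap`; the swap is
`θ ↦ π/2 - θ` on the circle); by `prod_overlap_reflectedLoop` the cyclic product is
`d₋ conj(d₊) |P|²`, and the clause makes its real part negative.  No continuity or gap hypothesis
enters. Hatsugai (2006); Fukui–Hatsugai–Suzuki (2005); Longuet-Higgins (1975). [folklore] -/
theorem re_swapSign_mul_lt_zero_of_holonomy_neg (U : ℝ) (N : ℕ) (p : Fin 2 → ℝ) (hp : p 0 = p 1)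
    (r : ℝ)
    (hhol : ∃ n₀ : ℕ, ∀ n ≥ n₀, ∀ ψ : Fin n → Fock (Orb (FermionTorus 2 L)),
      (∀ i : Fin n, IsGroundStateInSector (spinTwistedHubbardTorus L U (fun ν : Fin 2 => p ν +
        r * (if ν = 0 then Real.cos (2 * Real.pi * (i : ℕ) / n)
          else Real.sin (2 * Real.pi * (i : ℕ) / n)))) N 0 (ψ i) ∧ star (ψ i) ⬝ᵥ ψ i = 1) →
      (∏ i : Fin n, star (ψ i) ⬝ᵥ ψ (finRotate n i)).re < 0)
    {χp χm : Fock (Orb (FermionTorus 2 L))} {dp dm : ℂ}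
    (hχp : IsGroundStateInSector (spinTwistedHubbardTorus L U (fun ν : Fin 2 => p ν +
        r * (if ν = 0 then Real.cos (Real.pi / 4) else Real.sin (Real.pi / 4)))) N 0 χp)
    (hχm : IsGroundStateInSector (spinTwistedHubbardTorus L U (fun ν : Fin 2 => p ν +
        r * (if ν = 0 then Real.cos (5 * Real.pi / 4) else Real.sin (5 * Real.pi / 4)))) N 0 χm)
    (hdp : (fockD4 (L := L) (DihedralGroup.sr 3)).val *ᵥ χp = dp • χp)
    (hdm : (fockD4 (L := L) (DihedralGroup.sr 3)).val *ᵥ χm = dm • χm) :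
    (dm * star dp).re < 0 := by
  classical
  obtain ⟨n₀, hn₀⟩ := hhol
  -- the mesh `n = 8m`, `m ≥ max n₀ 1`
  set m : ℕ := max n₀ 1 with hmdef
  have hm : 1 ≤ m := le_max_right _ _
  have hmn : n₀ ≤ 8 * m := by
    have h := le_max_left n₀ 1
    rw [← hmdef] at h
    omega
  -- the swap as a map of vectors; it preserves inner products
  set Γ : Fock (Orb (FermionTorus 2 L)) → Fock (Orb (FermionTorus 2 L)) :=
    fun v => (fockD4 (L := L) (DihedralGroup.sr 3)).val *ᵥ v with hΓdef
  have hΓ : ∀ v w : Fock (Orb (FermionTorus 2 L)), star (Γ v) ⬝ᵥ Γ w = star v ⬝ᵥ w :=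
    fun v w => star_fockRelabel_mulVec_dotProduct_fockRelabel_mulVec _ v w
  -- unit sector ground states exist at every twist (the sector contains `χp ≠ 0`)
  have hK : (szSector N 0 : Submodule ℂ (Fock (Orb (FermionTorus 2 L)))) ≠ ⊥ :=
    (Submodule.ne_bot_iff _).2 ⟨χp, hχp.1, hχp.2.1⟩
  have hex : ∀ φ : Fin 2 → ℝ, ∃ v : Fock (Orb (FermionTorus 2 L)),
      IsGroundStateInSector (spinTwistedHubbardTorus L U φ) N 0 v ∧ star v ⬝ᵥ v = 1 := fun φ => by
    obtain ⟨v, hv, h1, he⟩ := exists_unit_eigen_minEnergyOn (spinTwistedHubbardTorus_isHermitian L U φ)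
      (szSector N 0) (fun v hv => spinTwistedHubbardTorus_mulVec_mem_szSector L U φ hv) hK
    exact ⟨v, ⟨hv, ne_zero_of_unit h1, he⟩, h1⟩
  choose v hv using hex
  -- normalised junction vectors
  obtain ⟨cp, hcp, hcp1⟩ := exists_smul_unit hχp.2.1
  obtain ⟨cm, hcm, hcm1⟩ := exists_smul_unit hχm.2.1
  -- the upper half of the polygon
  set θ : ℕ → ℝ := fun j => 2 * Real.pi * (j : ℝ) / ((8 * m : ℕ) : ℝ) with hθdef
  set pt : ℝ → Fin 2 → ℝ := fun t ν => p ν + r * (if ν = 0 then Real.cos t else Real.sin t)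
    with hptdef
  set u : ℕ → Fock (Orb (FermionTorus 2 L)) := fun j =>
    if j = m then cp • χp else if j = 5 * m then cm • χm else v (pt (θ j)) with hudef
  have hum : u m = cp • χp := by simp only [hudef, if_pos rfl]
  have hu5 : u (5 * m) = cm • χm := by
    have h5 : (5 * m ≠ m) := by omega
    simp [hudef, h5]
  have hU1 : ∀ j : ℕ, IsGroundStateInSector (spinTwistedHubbardTorus L U (pt (θ j))) N 0 (u j) ∧
      star (u j) ⬝ᵥ u j = 1 := by
    intro j
    by_cases hjm : j = m
    · rw [hjm, hum]
      refine ⟨?_, hcp1⟩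
      have hq : pt (θ m) = fun ν : Fin 2 => p ν +
          r * (if ν = 0 then Real.cos (Real.pi / 4) else Real.sin (Real.pi / 4)) := by
        simp only [hptdef, hθdef]
        rw [angle_m hm]
      rw [hq]
      exact isGroundStateInSector_smul hχp hcp
    by_cases hj5 : j = 5 * m
    · rw [hj5, hu5]
      refine ⟨?_, hcm1⟩
      have hq : pt (θ (5 * m)) = fun ν : Fin 2 => p ν +
          r * (if ν = 0 then Real.cos (5 * Real.pi / 4) else Real.sin (5 * Real.pi / 4)) := by
        simp only [hptdef, hθdef]
        rw [angle_5m hm]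
      rw [hq]
      exact isGroundStateInSector_smul hχm hcm
    · have hu : u j = v (pt (θ j)) := by simp only [hudef, if_neg hjm, if_neg hj5]
      rw [hu]
      exact hv _
  have hU2 : Γ (u m) = dp • u m := by
    simp only [hΓdef]
    rw [hum, mulVec_smul, hdp, smul_smul, smul_smul, mul_comm]
  have hU3 : Γ (u (5 * m)) = dm • u (5 * m) := by
    simp only [hΓdef]
    rw [hu5, mulVec_smul, hdm, smul_smul, smul_smul, mul_comm]
  -- the closed polygon: reflect the upper half
  set Ψ : ℕ → Fock (Orb (FermionTorus 2 L)) := fun i =>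
    if i < m then Γ (u (2 * m - i)) else if i ≤ 5 * m then u i else Γ (u (10 * m - i)) with hΨdef
  have hlo : ∀ i, i < m → Ψ i = Γ (u (2 * m - i)) := fun i hi => by
    simp only [hΨdef, if_pos hi]
  have hmid : ∀ i, m ≤ i → i ≤ 5 * m → Ψ i = u i := fun i h1 h2 => by
    simp only [hΨdef, if_neg (not_lt.2 h1), if_pos h2]
  have hhi : ∀ i, 5 * m < i → i ≤ 8 * m → Ψ i = Γ (u (10 * m - i)) := fun i h1 _ => by
    simp only [hΨdef, if_neg (show ¬ i < m by omega), if_neg (not_le.2 h1)]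
  -- the swap is `θ ↦ π/2 - θ` on the circle about the diagonal point `p`; `2π`-periodicity
  have hswap_pt : ∀ t : ℝ, (![pt t 1, pt t 0] : Fin 2 → ℝ) = pt (Real.pi / 2 - t) := fun t => by
    simp only [hptdef]
    funext ν
    fin_cases ν
    · simp [Real.cos_pi_div_two_sub, hp]
    · simp [Real.sin_pi_div_two_sub, hp]
  have hper : ∀ t : ℝ, pt (t - 2 * Real.pi) = pt t := fun t => by
    simp only [hptdef, Real.cos_sub_two_pi, Real.sin_sub_two_pi]
  -- every vertex of the polygon is a unit sector ground state at the right twist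
  have hswapGS : ∀ j : ℕ, IsGroundStateInSector
      (spinTwistedHubbardTorus L U (pt (Real.pi / 2 - θ j))) N 0 (Γ (u j)) ∧
      star (Γ (u j)) ⬝ᵥ Γ (u j) = 1 := by
    intro j
    refine ⟨?_, by rw [hΓ]; exact (hU1 j).2⟩
    have h := isGroundStateInSector_swap L (hU1 j).1
    rw [hswap_pt] at h
    exact h
  have hΨGS : ∀ i, i ≤ 8 * m → IsGroundStateInSector (spinTwistedHubbardTorus L U (pt (θ i))) N 0 (Ψ i) ∧
      star (Ψ i) ⬝ᵥ Ψ i = 1 := by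
    intro i hi8
    by_cases h1 : i < m
    · rw [hlo i h1]
      have h := hswapGS (2 * m - i)
      have hang : Real.pi / 2 - θ (2 * m - i) = θ i := by
        simp only [hθdef]
        rw [angle_reflect_lo hm (by omega), sub_sub_cancel]
      rwa [hang] at h
    by_cases h2 : i ≤ 5 * m
    · rw [hmid i (not_lt.1 h1) h2]
      exact hU1 i
    · rw [hhi i (not_le.1 h2) hi8]
      have h := hswapGS (10 * m - i)
      have hang : Real.pi / 2 - θ (10 * m - i) = θ i - 2 * Real.pi := by
        simp only [hθdef]
        rw [angle_reflect_hi hm (by omega)]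
        ring
      rwa [hang, hper] at h
  -- apply the holonomy clause to the polygon
  have key := hn₀ (8 * m) hmn (fun i => Ψ i) fun i => hΨGS i i.isLt.le
  rw [prod_finRotate_eq_prod_range (by omega : 1 ≤ 8 * m) Ψ
      (by rw [hhi (8 * m) (by omega) le_rfl, hlo 0 (by omega),
        show 10 * m - 8 * m = 2 * m - 0 from by omega]),
    prod_overlap_reflectedLoop Γ hΓ hm u hU2 hU3 (hU1 m).2 (hU1 (5 * m)).2 Ψ hlo hmid hhi] at key
  -- `conj(P) P = |P|² ≥ 0`
  set P : ℂ := ∏ i ∈ Ico m (5 * m), star (u i) ⬝ᵥ u (i + 1) with hP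
  have hPP : star P * P = ((‖P‖ ^ 2 : ℝ) : ℂ) := by
    rw [Complex.star_def, Complex.conj_mul']
    push_cast
    rfl
  rw [hPP, Complex.re_mul_ofReal] at key
  by_contra hge
  exact absurd key (not_lt.2 (mul_nonneg (not_lt.1 hge) (sq_nonneg _)))

/-- **The diagonal parity flip.**  In the situation of `re_swapSign_mul_lt_zero_of_holonomy_neg`,
if the `(N, S^z = 0)` sector ground states at the two diagonal vertices `p + r (cos π/4, sin π/4)`
and `p + r (cos 5π/4, sin 5π/4)` are unique up to scalars, then they are `±1` eigenvectors of the
swap `U_{sr 3}` (the diagonal vertices are diagonal twists, where the swap is a symmetry: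
`relabel_swap_of_diagonal`, `fockRelabel_mapEquiv_mulVec_eq_self_or_eq_neg`) with OPPOSITE signs:
the `x ↔ y` parity of the ground state flips across a diagonal Dirac point of holonomy `-1`.
Hatsugai (2006); Longuet-Higgins (1975). [folklore] -/
theorem swapSign_opposite_of_holonomy_neg (U : ℝ) (N : ℕ) (p : Fin 2 → ℝ) (hp : p 0 = p 1)
    (r : ℝ)
    (hhol : ∃ n₀ : ℕ, ∀ n ≥ n₀, ∀ ψ : Fin n → Fock (Orb (FermionTorus 2 L)),
      (∀ i : Fin n, IsGroundStateInSector (spinTwistedHubbardTorus L U (fun ν : Fin 2 => p ν +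
        r * (if ν = 0 then Real.cos (2 * Real.pi * (i : ℕ) / n)
          else Real.sin (2 * Real.pi * (i : ℕ) / n)))) N 0 (ψ i) ∧ star (ψ i) ⬝ᵥ ψ i = 1) →
      (∏ i : Fin n, star (ψ i) ⬝ᵥ ψ (finRotate n i)).re < 0)
    {χp χm : Fock (Orb (FermionTorus 2 L))}
    (hχp : IsGroundStateInSector (spinTwistedHubbardTorus L U (fun ν : Fin 2 => p ν +
        r * (if ν = 0 then Real.cos (Real.pi / 4) else Real.sin (Real.pi / 4)))) N 0 χp)
    (huniqp : ∀ χ', IsGroundStateInSector (spinTwistedHubbardTorus L U (fun ν : Fin 2 => p ν +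
        r * (if ν = 0 then Real.cos (Real.pi / 4) else Real.sin (Real.pi / 4)))) N 0 χ' →
        ∃ z : ℂ, χ' = z • χp)
    (hχm : IsGroundStateInSector (spinTwistedHubbardTorus L U (fun ν : Fin 2 => p ν +
        r * (if ν = 0 then Real.cos (5 * Real.pi / 4) else Real.sin (5 * Real.pi / 4)))) N 0 χm)
    (huniqm : ∀ χ', IsGroundStateInSector (spinTwistedHubbardTorus L U (fun ν : Fin 2 => p ν +
        r * (if ν = 0 then Real.cos (5 * Real.pi / 4) else Real.sin (5 * Real.pi / 4)))) N 0 χ' →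
        ∃ z : ℂ, χ' = z • χm) :
    ((fockD4 (L := L) (DihedralGroup.sr 3)).val *ᵥ χp = χp ∧
        (fockD4 (L := L) (DihedralGroup.sr 3)).val *ᵥ χm = -χm) ∨
      ((fockD4 (L := L) (DihedralGroup.sr 3)).val *ᵥ χp = -χp ∧
        (fockD4 (L := L) (DihedralGroup.sr 3)).val *ᵥ χm = χm) := by
  -- the two diagonal vertices are diagonal twists
  have h45 : Real.cos (5 * Real.pi / 4) = Real.sin (5 * Real.pi / 4) := by
    rw [show 5 * Real.pi / 4 = Real.pi / 4 + Real.pi by ring, Real.cos_add_pi, Real.sin_add_pi,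
      Real.cos_pi_div_four, Real.sin_pi_div_four]
  have hdiagp : (fun ν : Fin 2 => p ν +
      r * (if ν = 0 then Real.cos (Real.pi / 4) else Real.sin (Real.pi / 4))) 0 =
      (fun ν : Fin 2 => p ν + r * (if ν = 0 then Real.cos (Real.pi / 4) else Real.sin (Real.pi / 4))) 1 := by
    simp [Real.cos_pi_div_four, Real.sin_pi_div_four, hp]
  have hdiagm : (fun ν : Fin 2 => p ν +
      r * (if ν = 0 then Real.cos (5 * Real.pi / 4) else Real.sin (5 * Real.pi / 4))) 0 =
      (fun ν : Fin 2 => p ν +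
        r * (if ν = 0 then Real.cos (5 * Real.pi / 4) else Real.sin (5 * Real.pi / 4))) 1 := by
    simp [h45, hp]
  -- `±1` eigenvectors of the swap
  have hsp := fockRelabel_mapEquiv_mulVec_eq_self_or_eq_neg L _ (relabel_swap_of_diagonal L U hdiagp)
    hχp huniqp
  have hsm := fockRelabel_mapEquiv_mulVec_eq_self_or_eq_neg L _ (relabel_swap_of_diagonal L U hdiagm)
    hχm huniqm
  rw [← Orb.d4Perm_eq_mapEquiv] at hsp hsm
  change (fockD4 (L := L) (DihedralGroup.sr 3)).val *ᵥ χp = χp ∨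
    (fockD4 (L := L) (DihedralGroup.sr 3)).val *ᵥ χp = -χp at hsp
  change (fockD4 (L := L) (DihedralGroup.sr 3)).val *ᵥ χm = χm ∨
    (fockD4 (L := L) (DihedralGroup.sr 3)).val *ᵥ χm = -χm at hsm
  -- equal signs contradict `Re (d₋ conj d₊) < 0`
  have key := fun (dp dm : ℂ) (hdp : (fockD4 (L := L) (DihedralGroup.sr 3)).val *ᵥ χp = dp • χp)
      (hdm : (fockD4 (L := L) (DihedralGroup.sr 3)).val *ᵥ χm = dm • χm) =>
    re_swapSign_mul_lt_zero_of_holonomy_neg L U N p hp r hhol hχp hχm hdp hdm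
  rcases hsp with hsp | hsp <;> rcases hsm with hsm | hsm
  · have h := key 1 1 (by rw [hsp, one_smul]) (by rw [hsm, one_smul])
    norm_num at h
  · exact Or.inl ⟨hsp, hsm⟩
  · exact Or.inr ⟨hsp, hsm⟩
  · have h := key (-1) (-1) (by rw [hsp, neg_one_smul]) (by rw [hsm, neg_one_smul])
    norm_num at h

end Flip

/-- **Registered sub-goal `stub_diagonalParityFlip` of crux stmt-HubbardSuperconductivity-10395**
(lead c12, line `birth`; structural input to stub C): the statement of
`swapSign_opposite_of_holonomy_neg` with all binders explicit and all names fully qualified — at a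
diagonal twist `p` (`p₀ = p₁`) carrying the holonomy clause of the nodal-Dirac package for the
radius `r`, unique `(N, S^z = 0)` sector ground states at the two diagonal vertices of the circle
are eigenvectors of the swap `U_{sr 3}` with OPPOSITE signs `±1`. Hatsugai, J. Phys. Soc. Jpn. 75
(2006) 123601; Longuet-Higgins, Proc. R. Soc. A 344 (1975) 147. [folklore] -/
theorem stub_diagonalParityFlip : ∀ (L : ℕ) [NeZero L] (U : ℝ) (N : ℕ) (p : Fin 2 → ℝ), p 0 = p 1 → ∀ (r : ℝ), (∃ n₀ : ℕ, ∀ n ≥ n₀, ∀ ψ : Fin n → Literature.MathematicalPhysics.QuantumLattice.Fock (Literature.MathematicalPhysics.QuantumLattice.Orb (Literature.MathematicalPhysics.QuantumLattice.FermionTorus 2 L)), (∀ i : Fin n, Literature.MathematicalPhysics.QuantumLattice.IsGroundStateInSector (Literature.MathematicalPhysics.QuantumLattice.spinTwistedHubbardTorus L U (fun ν : Fin 2 => p ν + r * (if ν = 0 then Real.cos (2 * Real.pi * (i : ℕ) / n) else Real.sin (2 * Real.pi * (i : ℕ) / n)))) N 0 (ψ i) ∧ star (ψ i) ⬝ᵥ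 ψ i = 1) → (∏ i : Fin n, star (ψ i) ⬝ᵥ ψ (finRotate n i)).re < 0) → ∀ (χp χm : Literature.MathematicalPhysics.QuantumLattice.Fock (Literature.MathematicalPhysics.QuantumLattice.Orb (Literature.MathematicalPhysics.QuantumLattice.FermionTorus 2 L))), Literature.MathematicalPhysics.QuantumLattice.IsGroundStateInSector (Literature.MathematicalPhysics.QuantumLattice.spinTwistedHubbardTorus L U (fun ν : Fin 2 => p ν + r * (if ν = 0 then Real.cos (Real.pi / 4) else Real.sin (Real.pi / 4)))) N 0 χp → (∀ χ' : Literature.MathematicalPhysics.QuantumLattice.Fock (Literature.MathematicalPhysics.QuantumLattice.Orb (Literature.MathematicalPhysics.QuantumLattice.FermionTorus 2 L)), Literature.MathematicalPhysics.QuantumLattice.IsGroundStateInSector (Literature.MathematicalPhysics.QuantumLattice.spinTwistedHubbardTorus L U (fun ν : Fin 2 => p ν + r * (if ν = 0 then Real.cos (Real.pi / 4) else Real.sin (Real.pi / 4)))) N 0 χ' → ∃ z : ℂ, χ' = z • χp) → Literature.MathematicalPhysics.QuantumLattice.IsGroundStateInSector (Literature.MathematicalPhysics.QuantumLattice.spinTwistedHubbardTorus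 L U (fun ν : Fin 2 => p ν + r * (if ν = 0 then Real.cos (5 * Real.pi / 4) else Real.sin (5 * Real.pi / 4)))) N 0 χm → (∀ χ' : Literature.MathematicalPhysics.QuantumLattice.Fock (Literature.MathematicalPhysics.QuantumLattice.Orb (Literature.MathematicalPhysics.QuantumLattice.FermionTorus 2 L)), Literature.MathematicalPhysics.QuantumLattice.IsGroundStateInSector (Literature.MathematicalPhysics.QuantumLattice.spinTwistedHubbardTorus L U (fun ν : Fin 2 => p ν + r * (if ν = 0 then Real.cos (5 * Real.pi / 4) else Real.sin (5 * Real.pi / 4)))) N 0 χ' → ∃ z : ℂ, χ' = z • χm) → (Matrix.mulVec (Literature.MathematicalPhysics.QuantumLattice.fockD4 (L := L) (DihedralGroup.sr 3)).val χp = χp ∧ Matrix.mulVec (Literature.MathematicalPhysics.QuantumLattice.fockD4 (L := L) (DihedralGroup.sr 3)).val χm = -χm) ∨ (Matrix.mulVec (Literature.MathematicalPhysics.QuantumLattice.fockD4 (L := L) (DihedralGroup.sr 3)).val χp = -χp ∧ Matrix.mulVec (Literature.MathematicalPhysics.QuantumLattice.fockD4 (L := L) (DihedralGroup.sr 3)).val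 χm = χm) :=
  fun L _ U N p hp r hhol _ _ hχp huniqp hχm huniqm =>
    swapSign_opposite_of_holonomy_neg L U N p hp r hhol hχp huniqp hχm huniqm

end Summit.HubbardSuperconductivity.HubbardSuperconductivity.Theorems.NodalDiracTwist.BridgeNodalToDWave

end
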